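import Mathlib
import Summits.ValiantsHypothesis.ValiantsHypothesis.Theorems.LiouvilleSarnakAlignedTypeICharactersMod2nParseval
import HarnessLib

/-!
# Route LiouvilleSarnak — support `AlignedTypeI` (stmt-ValiantsHypothesis-21040), line `characters_mod_2n`:
# tools for the bilinear (Turán–Kubilius × large-sieve) reduction of the character mean square

After `…CharactersMod2nParseval.lean` (`alignedTypeI_of_charMeanSquare`) the crux `AlignedTypeI` follows from a MEAN-SQUARE
statement over the Dirichlet characters `ψ ≠ χ₁` to the moduli `2^k ≤ √x`: `Σ_{ψ ≠ χ₁} |Σ_{m ≤ x} λ(m) ψ(m)|² = o(x²)`.  The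
hands g0–g3 cited this from Klurman–Mangerel–Teräväinen 2023 (Thm 1.3, an XL named fact).  This file starts a DIFFERENT,
elementary decomposition of the same mean square (with `χ₁ = 1`), after Turán–Kubilius and the large sieve for ONE modulus:
`L · Σ_m λψ(m) = Σ_m λψ(m) ω_𝒫(m) − Σ_m λψ(m)(ω_𝒫(m) − L)` (`ω_𝒫(m) = #{p ∈ 𝒫 : p ∣ m}`, `L = Σ_{p ∈ 𝒫} 1/p`), where the
first sum is the bilinear form `−Σ_{p ∈ 𝒫} ψ(p) Σ_{r ≤ x/p} λψ(r)` (the only place the arithmetic of `λ` enters: `λ(pr) = −λ(r)`).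

Contents (all folklore, def-free, general modulus `q`):
* §1 `parseval_chars`, `sum_mul_char_eq_sum_units`, `sum_char_norm_sq_eq_fibres` — Plancherel over the characters mod `q`
  with fibres; `largeSieve_single` — the large sieve for one modulus: `Σ_ψ |Σ_i c_i ψ(n_i)|² ≤ φ(q) · N · Σ_i |c_i|²` whenever
  every reduced class contains at most `N` of the indices `n_i`.
* §2 `sum_Icc_filter_dvd_eq`, `sum_Icc_sum_filter_dvd_eq` — multiples of `p` in `[1, x]` versus `[1, x/p]` (the reindexing
  behind `Σ_m a(m) ω_𝒫(m) = Σ_{p ∈ 𝒫} Σ_{r ≤ x/p} a(pr)`).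
* §3 `card_Ioc_filter_dvd_le`, `sum_Ioc_card_filter_dvd_sq_le` — multiples in a short interval and the second moment of
  `ω_𝒫` on `(a, b]`: `≤ (b − a)(L² + L) + |𝒫|² + |𝒫|`.
(The Turán–Kubilius bound `Σ_{m ≤ x} (ω_𝒫(m) − L)² ≤ 278 · x · L`, from the tree's `TuranKubilius.turanKubilius_prime`,
lives in the companion file `…BilinearSieveTK.lean`, to keep this file's import closure inside Mathlib + the line's files.)

HONEST FRAMING. Bookkeeping lemmas only; nothing conditional is discharged; `AlignedTypeI` is NOT closed here and nothing
bears on `VP ≠ VNP` (NOT proved).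
-/

set_option linter.dupNamespace false

noncomputable section

namespace Summit.ValiantsHypothesis.ValiantsHypothesis.Theorems.LiouvilleSarnak.AlignedTypeI.CharactersModTwoN

open ArithmeticFunction Finset
open scoped BigOperators

/-! ## §1 Plancherel over the characters and the large sieve for one modulus -/

/-- **Parseval, character side**: `Σ_ψ |Σ_{u ∈ (ℤ/q)ˣ} d(u) ψ(u)|² = φ(q) Σ_u |d(u)|²`. [folklore] -/
theorem parseval_chars {q : ℕ} [NeZero q] (d : (ZMod q)ˣ → ℂ) :
    ∑ ψ : DirichletCharacter ℂ q, ‖∑ u : (ZMod q)ˣ, d u * ψ (u : ZMod q)‖ ^ 2 =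
      (Nat.totient q : ℝ) * ∑ u : (ZMod q)ˣ, ‖d u‖ ^ 2 := by
  have key : ∀ ψ : DirichletCharacter ℂ q, ((‖∑ u : (ZMod q)ˣ, d u * ψ (u : ZMod q)‖ : ℂ)) ^ 2 =
      ∑ u : (ZMod q)ˣ, ∑ u' : (ZMod q)ˣ,
        d u * star (d u') * (ψ (u : ZMod q) * star (ψ (u' : ZMod q))) := by
    intro ψ
    rw [← Complex.mul_conj', map_sum, Finset.sum_mul_sum]
    refine Finset.sum_congr rfl fun u _ => Finset.sum_congr rfl fun u' _ => ?_
    rw [map_mul]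
    simp only [Complex.star_def]
    ring
  apply Complex.ofReal_injective
  push_cast
  rw [Finset.sum_congr rfl fun ψ (_ : ψ ∈ Finset.univ) => key ψ]
  calc ∑ ψ : DirichletCharacter ℂ q, ∑ u : (ZMod q)ˣ, ∑ u' : (ZMod q)ˣ,
        d u * star (d u') * (ψ (u : ZMod q) * star (ψ (u' : ZMod q)))
      = ∑ u : (ZMod q)ˣ, ∑ ψ : DirichletCharacter ℂ q, ∑ u' : (ZMod q)ˣ,
        d u * star (d u') * (ψ (u : ZMod q) * star (ψ (u' : ZMod q))) := Finset.sum_comm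
    _ = ∑ u : (ZMod q)ˣ, ∑ u' : (ZMod q)ˣ, ∑ ψ : DirichletCharacter ℂ q,
        d u * star (d u') * (ψ (u : ZMod q) * star (ψ (u' : ZMod q))) :=
        Finset.sum_congr rfl fun u _ => Finset.sum_comm
    _ = ∑ u : (ZMod q)ˣ, ∑ u' : (ZMod q)ˣ,
        d u * star (d u') * (if (u' : ZMod q) = (u : ZMod q) then (Nat.totient q : ℂ) else 0) := by
        refine Finset.sum_congr rfl fun u _ => Finset.sum_congr rfl fun u' _ => ?_
        rw [← Finset.mul_sum, sum_char_mul_conj_apply u (u' : ZMod q)]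
    _ = ∑ u : (ZMod q)ˣ, d u * star (d u) * (Nat.totient q : ℂ) := by
        refine Finset.sum_congr rfl fun u _ => ?_
        simp_rw [Units.val_inj, mul_ite, mul_zero]
        rw [Finset.sum_ite_eq']
        simp
    _ = (Nat.totient q : ℂ) * ∑ u : (ZMod q)ˣ, ((‖d u‖ : ℂ)) ^ 2 := by
        rw [Finset.mul_sum]
        refine Finset.sum_congr rfl fun u _ => ?_
        rw [← Complex.mul_conj', Complex.star_def]
        ring

/-- A character value as a sum over the units: `ψ(a) = Σ_u [a = u] ψ(u)` (both sides vanish off the units). [folklore] -/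
theorem apply_eq_sum_units_ite {q : ℕ} [NeZero q] (ψ : DirichletCharacter ℂ q) (a : ZMod q) :
    ψ a = ∑ u : (ZMod q)ˣ, if a = (u : ZMod q) then ψ (u : ZMod q) else 0 := by
  classical
  by_cases ha : IsUnit a
  · obtain ⟨u₀, rfl⟩ := ha
    simp_rw [Units.val_inj]
    rw [Finset.sum_ite_eq]
    simp
  · rw [ψ.map_nonunit ha]
    symm
    refine Finset.sum_eq_zero fun u _ => ?_
    rw [if_neg]
    rintro rfl
    exact ha (Units.isUnit u)

/-- Collecting a character sum along its fibres over the units: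
`Σ_i c_i ψ(n_i) = Σ_{u ∈ (ℤ/q)ˣ} (Σ_{i : n_i = u} c_i) ψ(u)`. [folklore] -/
theorem sum_mul_char_eq_sum_units {q : ℕ} [NeZero q] {ι : Type*} (I : Finset ι) (n : ι → ZMod q) (c : ι → ℂ)
    (ψ : DirichletCharacter ℂ q) :
    ∑ i ∈ I, c i * ψ (n i) =
      ∑ u : (ZMod q)ˣ, (∑ i ∈ I.filter (fun i => n i = (u : ZMod q)), c i) * ψ (u : ZMod q) := by
  classical
  simp_rw [Finset.sum_filter, Finset.sum_mul, ite_mul, zero_mul]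
  rw [Finset.sum_comm]
  refine Finset.sum_congr rfl fun i _ => ?_
  rw [apply_eq_sum_units_ite ψ (n i), Finset.mul_sum]
  simp_rw [mul_ite, mul_zero]

/-- **Plancherel with fibres**: `Σ_ψ |Σ_i c_i ψ(n_i)|² = φ(q) Σ_{u ∈ (ℤ/q)ˣ} |Σ_{i : n_i = u} c_i|²`. [folklore] -/
theorem sum_char_norm_sq_eq_fibres {q : ℕ} [NeZero q] {ι : Type*} (I : Finset ι) (n : ι → ZMod q) (c : ι → ℂ) :
    ∑ ψ : DirichletCharacter ℂ q, ‖∑ i ∈ I, c i * ψ (n i)‖ ^ 2 =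
      (Nat.totient q : ℝ) * ∑ u : (ZMod q)ˣ, ‖∑ i ∈ I.filter (fun i => n i = (u : ZMod q)), c i‖ ^ 2 := by
  classical
  simp_rw [sum_mul_char_eq_sum_units I n c]
  exact parseval_chars _

/-- Summing a nonnegative function over the fibres of `n : ι → ℤ/q` above the units undercounts the total. [folklore] -/
theorem sum_units_sum_filter_le {q : ℕ} [NeZero q] {ι : Type*} (I : Finset ι) (n : ι → ZMod q) (g : ι → ℝ)
    (hg : ∀ i ∈ I, 0 ≤ g i) :
    ∑ u : (ZMod q)ˣ, ∑ i ∈ I.filter (fun i => n i = (u : ZMod q)), g i ≤ ∑ i ∈ I, g i := by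
  classical
  simp_rw [Finset.sum_filter]
  rw [Finset.sum_comm]
  refine Finset.sum_le_sum fun i hi => ?_
  by_cases hu : IsUnit (n i)
  · obtain ⟨u₀, hu₀⟩ := hu
    simp_rw [← hu₀, Units.val_inj]
    rw [Finset.sum_ite_eq]
    simp
  · rw [Finset.sum_eq_zero]
    · exact hg i hi
    · intro u _
      rw [if_neg]
      intro h
      exact hu (h ▸ Units.isUnit u)

/-- **Large sieve for one modulus.**  If every reduced class mod `q` contains at most `N` of the indices `n_i`, then
`Σ_{ψ mod q} |Σ_i c_i ψ(n_i)|² ≤ φ(q) · N · Σ_i |c_i|²`. [folklore] -/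
theorem largeSieve_single {q : ℕ} [NeZero q] {ι : Type*} (I : Finset ι) (n : ι → ZMod q) (c : ι → ℂ) (N : ℕ)
    (hN : ∀ u : (ZMod q)ˣ, (I.filter (fun i => n i = (u : ZMod q))).card ≤ N) :
    ∑ ψ : DirichletCharacter ℂ q, ‖∑ i ∈ I, c i * ψ (n i)‖ ^ 2 ≤
      (Nat.totient q : ℝ) * N * ∑ i ∈ I, ‖c i‖ ^ 2 := by
  classical
  rw [sum_char_norm_sq_eq_fibres I n c, mul_assoc]
  gcongr
  calc ∑ u : (ZMod q)ˣ, ‖∑ i ∈ I.filter (fun i => n i = (u : ZMod q)), c i‖ ^ 2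
      ≤ ∑ u : (ZMod q)ˣ, ((N : ℝ) * ∑ i ∈ I.filter (fun i => n i = (u : ZMod q)), ‖c i‖ ^ 2) := by
        refine Finset.sum_le_sum fun u _ => ?_
        calc ‖∑ i ∈ I.filter (fun i => n i = (u : ZMod q)), c i‖ ^ 2
            ≤ (∑ i ∈ I.filter (fun i => n i = (u : ZMod q)), ‖c i‖) ^ 2 := by
              gcongr
              exact norm_sum_le _ _
          _ ≤ ((I.filter (fun i => n i = (u : ZMod q))).card : ℝ) *
                ∑ i ∈ I.filter (fun i => n i = (u : ZMod q)), ‖c i‖ ^ 2 := sq_sum_le_card_mul_sum_sq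
          _ ≤ (N : ℝ) * ∑ i ∈ I.filter (fun i => n i = (u : ZMod q)), ‖c i‖ ^ 2 := by
              gcongr
              exact_mod_cast hN u
    _ = (N : ℝ) * ∑ u : (ZMod q)ˣ, ∑ i ∈ I.filter (fun i => n i = (u : ZMod q)), ‖c i‖ ^ 2 := by
        rw [Finset.mul_sum]
    _ ≤ (N : ℝ) * ∑ i ∈ I, ‖c i‖ ^ 2 := by
        gcongr
        exact sum_units_sum_filter_le I n _ fun i _ => by positivity

/-! ## §2 Multiples of `p` in `[1, x]` versus `[1, x/p]` -/

/-- `Σ_{m ≤ x, p ∣ m} F(m) = Σ_{r ≤ x/p} F(pr)`. [folklore] -/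
theorem sum_Icc_filter_dvd_eq {M : Type*} [AddCommMonoid M] {p : ℕ} (hp : 0 < p) (x : ℕ) (F : ℕ → M) :
    ∑ m ∈ (Finset.Icc 1 x).filter (fun m => p ∣ m), F m = ∑ r ∈ Finset.Icc 1 (x / p), F (p * r) := by
  have himage : (Finset.Icc 1 x).filter (fun m => p ∣ m) = (Finset.Icc 1 (x / p)).image (fun r => p * r) := by
    ext m
    simp only [Finset.mem_filter, Finset.mem_Icc, Finset.mem_image]
    constructor
    · rintro ⟨⟨h1, h2⟩, ⟨r, rfl⟩⟩
      refine ⟨r, ⟨?_, ?_⟩, rfl⟩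
      · rcases Nat.eq_zero_or_pos r with h | h
        · subst h
          simp at h1
        · exact h
      · exact (Nat.le_div_iff_mul_le hp).mpr (by rw [mul_comm]; exact h2)
    · rintro ⟨r, ⟨h1, h2⟩, rfl⟩
      refine ⟨⟨Nat.one_le_iff_ne_zero.mpr (Nat.mul_ne_zero hp.ne' (by omega)), ?_⟩, dvd_mul_right p r⟩
      calc p * r ≤ p * (x / p) := Nat.mul_le_mul_left _ h2
        _ ≤ x := Nat.mul_div_le x p
  rw [himage, Finset.sum_image]
  intro a _ b _ hab
  exact Nat.eq_of_mul_eq_mul_left hp hab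

/-- The reindexing behind `Σ_m a(m) ω_𝒫(m) = Σ_{p ∈ 𝒫} Σ_{r ≤ x/p} a(pr)`:
`Σ_{m ≤ x} Σ_{p ∈ 𝒫, p ∣ m} F(p, m) = Σ_{p ∈ 𝒫} Σ_{r ≤ x/p} F(p, pr)`. [folklore] -/
theorem sum_Icc_sum_filter_dvd_eq {M : Type*} [AddCommMonoid M] (P : Finset ℕ) (hP : ∀ p ∈ P, 0 < p) (x : ℕ)
    (F : ℕ → ℕ → M) :
    ∑ m ∈ Finset.Icc 1 x, ∑ p ∈ P.filter (fun p => p ∣ m), F p m =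
      ∑ p ∈ P, ∑ r ∈ Finset.Icc 1 (x / p), F p (p * r) := by
  rw [show (∑ m ∈ Finset.Icc 1 x, ∑ p ∈ P.filter (fun p => p ∣ m), F p m) =
      ∑ p ∈ P, ∑ m ∈ (Finset.Icc 1 x).filter (fun m => p ∣ m), F p m by
    simp_rw [Finset.sum_filter]
    exact Finset.sum_comm]
  exact Finset.sum_congr rfl fun p hp => sum_Icc_filter_dvd_eq (hP p hp) x (F p)

/-! ## §3 Multiples in a short interval; the second moment of `ω_𝒫` on `(a, b]` -/

/-- Multiples of `d` in `(a, b]`: at most `(b − a)/d + 1`. [folklore] -/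
theorem card_Ioc_filter_dvd_le {d : ℕ} (hd : 0 < d) {a b : ℕ} (hab : a ≤ b) :
    (((Finset.Ioc a b).filter (fun m => d ∣ m)).card : ℝ) ≤ ((b : ℝ) - a) / d + 1 := by
  have hunion : (Finset.Ioc 0 b).filter (fun m => d ∣ m) =
      (Finset.Ioc 0 a).filter (fun m => d ∣ m) ∪ (Finset.Ioc a b).filter (fun m => d ∣ m) := by
    rw [← Finset.filter_union, Finset.Ioc_union_Ioc_eq_Ioc (Nat.zero_le a) hab]
  have hdisj : Disjoint ((Finset.Ioc 0 a).filter (fun m => d ∣ m)) ((Finset.Ioc a b).filter (fun m => d ∣ m)) :=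
    Finset.disjoint_filter_filter (Finset.Ioc_disjoint_Ioc_of_le (le_refl a))
  have hcard : ((Finset.Ioc a b).filter (fun m => d ∣ m)).card = b / d - a / d := by
    have h := Finset.card_union_of_disjoint hdisj
    rw [← hunion, Nat.Ioc_filter_dvd_card_eq_div, Nat.Ioc_filter_dvd_card_eq_div] at h
    omega
  rw [hcard, Nat.cast_sub (Nat.div_le_div_right hab)]
  have hb : ((b / d : ℕ) : ℝ) ≤ (b : ℝ) / d := Nat.cast_div_le
  have ha : (a : ℝ) / d - 1 < ((a / d : ℕ) : ℝ) := by
    have h := Nat.lt_div_mul_add hd (a := a)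
    have hdR : (0 : ℝ) < d := by exact_mod_cast hd
    rw [div_sub_one hdR.ne', div_lt_iff₀ hdR]
    have : (a : ℝ) < ((a / d : ℕ) : ℝ) * d + d := by exact_mod_cast h
    linarith
  rw [sub_div]
  linarith

/-- **Second moment of `ω_𝒫` on a short interval.**  For a finite set `𝒫` of primes, `a ≤ b`, `L = Σ_{p ∈ 𝒫} 1/p`:
`Σ_{m ∈ (a, b]} #{p ∈ 𝒫 : p ∣ m}² ≤ (b − a) L² + (b − a) L + |𝒫|²`. [folklore] -/
theorem sum_Ioc_card_filter_dvd_sq_le (P : Finset ℕ) (hP : ∀ p ∈ P, p.Prime) {a b : ℕ} (hab : a ≤ b) :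
    ∑ m ∈ Finset.Ioc a b, (((P.filter (fun p => p ∣ m)).card : ℝ)) ^ 2 ≤
      ((b : ℝ) - a) * (∑ p ∈ P, (1 : ℝ) / p) ^ 2 + ((b : ℝ) - a) * (∑ p ∈ P, (1 : ℝ) / p) + (P.card : ℝ) ^ 2 := by
  classical
  have hba : (0 : ℝ) ≤ (b : ℝ) - a := by
    have : (a : ℝ) ≤ b := by exact_mod_cast hab
    linarith
  -- `ω(m)² = Σ_{p, p' ∈ 𝒫} [p ∣ m][p' ∣ m]`
  have hsq : ∀ m, (((P.filter (fun p => p ∣ m)).card : ℝ)) ^ 2 =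
      ∑ p ∈ P, ∑ p' ∈ P, if p ∣ m ∧ p' ∣ m then (1 : ℝ) else 0 := by
    intro m
    rw [Finset.card_filter, Nat.cast_sum, sq, Finset.sum_mul_sum]
    refine Finset.sum_congr rfl fun p _ => Finset.sum_congr rfl fun p' _ => ?_
    push_cast
    split_ifs <;> simp_all
  -- each pair contributes the multiples of `pp'` (or of `p` on the diagonal)
  have hterm : ∀ p ∈ P, ∀ p' ∈ P,
      ∑ m ∈ Finset.Ioc a b, (if p ∣ m ∧ p' ∣ m then (1 : ℝ) else 0) ≤
        ((b : ℝ) - a) / ((p : ℝ) * p') + 1 + (if p = p' then ((b : ℝ) - a) / p else 0) := by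
    intro p hp p' hp'
    have hpp := hP p hp
    have hpp' := hP p' hp'
    rw [← Finset.sum_filter, Finset.sum_const, nsmul_eq_mul, mul_one]
    by_cases h : p = p'
    · subst h
      rw [if_pos rfl]
      have hset : (Finset.Ioc a b).filter (fun m => p ∣ m ∧ p ∣ m) = (Finset.Ioc a b).filter (fun m => p ∣ m) := by
        simp_rw [and_self]
      rw [hset]
      have h1 := card_Ioc_filter_dvd_le hpp.pos hab
      have h2 : 0 ≤ ((b : ℝ) - a) / ((p : ℝ) * p) := by positivity
      linarith
    · rw [if_neg h, add_zero]
      have hcop : Nat.Coprime p p' := (Nat.coprime_primes hpp hpp').mpr h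
      have hset : (Finset.Ioc a b).filter (fun m => p ∣ m ∧ p' ∣ m) =
          (Finset.Ioc a b).filter (fun m => p * p' ∣ m) :=
        Finset.filter_congr fun m _ =>
          ⟨fun ⟨h1, h2⟩ => hcop.mul_dvd_of_dvd_of_dvd h1 h2,
            fun h1 => ⟨dvd_trans (dvd_mul_right p p') h1, dvd_trans (dvd_mul_left p' p) h1⟩⟩
      rw [hset]
      have h1 := card_Ioc_filter_dvd_le (Nat.mul_pos hpp.pos hpp'.pos) hab
      push_cast at h1
      exact h1
  calc ∑ m ∈ Finset.Ioc a b, (((P.filter (fun p => p ∣ m)).card : ℝ)) ^ 2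
      = ∑ m ∈ Finset.Ioc a b, ∑ p ∈ P, ∑ p' ∈ P, (if p ∣ m ∧ p' ∣ m then (1 : ℝ) else 0) :=
        Finset.sum_congr rfl fun m _ => hsq m
    _ = ∑ p ∈ P, ∑ p' ∈ P, ∑ m ∈ Finset.Ioc a b, (if p ∣ m ∧ p' ∣ m then (1 : ℝ) else 0) := by
        rw [Finset.sum_comm]
        exact Finset.sum_congr rfl fun p _ => Finset.sum_comm
    _ ≤ ∑ p ∈ P, ∑ p' ∈ P, (((b : ℝ) - a) / ((p : ℝ) * p') + 1 + (if p = p' then ((b : ℝ) - a) / p else 0)) :=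
        Finset.sum_le_sum fun p hp => Finset.sum_le_sum fun p' hp' => hterm p hp p' hp'
    _ = ((b : ℝ) - a) * (∑ p ∈ P, (1 : ℝ) / p) ^ 2 + (P.card : ℝ) ^ 2 +
          ((b : ℝ) - a) * (∑ p ∈ P, (1 : ℝ) / p) := by
        simp_rw [Finset.sum_add_distrib]
        have h1 : ∑ p ∈ P, ∑ p' ∈ P, ((b : ℝ) - a) / ((p : ℝ) * p') =
            ((b : ℝ) - a) * (∑ p ∈ P, (1 : ℝ) / p) ^ 2 := by
          rw [sq, Finset.sum_mul_sum, Finset.mul_sum]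
          refine Finset.sum_congr rfl fun p hp => ?_
          rw [Finset.mul_sum]
          refine Finset.sum_congr rfl fun p' hp' => ?_
          have hp0 : (0 : ℝ) < p := by exact_mod_cast (hP p hp).pos
          have hp0' : (0 : ℝ) < p' := by exact_mod_cast (hP p' hp').pos
          field_simp
        have h2 : ∑ p ∈ P, ∑ p' ∈ P, (1 : ℝ) = (P.card : ℝ) ^ 2 := by
          simp [sq]
        have h3 : ∑ p ∈ P, ∑ p' ∈ P, (if p = p' then ((b : ℝ) - a) / p else 0) =
            ((b : ℝ) - a) * ∑ p ∈ P, (1 : ℝ) / p := by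
          rw [Finset.mul_sum]
          refine Finset.sum_congr rfl fun p hp => ?_
          rw [Finset.sum_ite_eq]
          rw [if_pos hp]
          ring
        rw [h1, h2, h3]
    _ = _ := by ring

end Summit.ValiantsHypothesis.ValiantsHypothesis.Theorems.LiouvilleSarnak.AlignedTypeI.CharactersModTwoN
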